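import Literature.MathematicalPhysics.QuantumLattice.DWaveSourceEnergyDensity
import Literature.MathematicalPhysics.QuantumLattice.DWaveSourceNNNHopping
import Literature.MathematicalPhysics.QuantumLattice.HubbardNNNHoppingInteraction
import HarnessLib

/-!
# The `d`-wave pair-sourced `t–t'` Hubbard torus (pinning field): the local energy-density observable
# and the thermodynamic-limit ground-state energy density `e_src(t', U, μ, h)` (definitions)

Topic `Literature/MathematicalPhysics/QuantumLattice` (family `hubbard`); the `t' ≠ 0` TWIN of
`DWaveSourceEnergyDensity.lean`, for the pair-sourced grand-canonical `t–t'` torus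
`A_L(t',U,μ,h) = hubbardTorusTT' L 1 t' U − μN_L − h(Δ_d + Δ_d†)` (`dWaveSourceTorusTT' L t' U μ h`,
`DWaveSourceNNNHopping.lean`; Xu et al. (2024) eq. (1) with the Koma–Tasaki source). Written for the
cuprate cell (`hubbard-cq`): the CQ anchors are `(U, n, t') = (8, 7/8, 0)` AND `(8, 7/8, −1/4)`. This file
only NAMES two objects; the theorems are in `DWaveSourceNNNHoppingEnergyDensityExists.lean`.

* `dWaveSourceEnergyObsTT' t' U μ h ∈ 𝔄_W` (`W = dWaveSourceWindow`) — the local objective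
  `Γ(E_Φ(1,t',U)) − μ (n_{0↑} + n_{0↓}) − h (Γ Φ₀ + (Γ Φ₀)†)`, literally the expression whose torus
  translates sum to `A_L` in the tree's `sum_conj_fockTranslate_pairSourceObjectiveTT'_dWave`;
* `dWaveSourceEnergyDensityTT' t' U μ h = lim_L E₀(A_{L+1}(t',U,μ,h))/(L+1)²` (`limUnder`).

## References
* T. Koma, H. Tasaki, J. Stat. Phys. 76 (1994) 745, §1. [cite: KomaTasaki1994, §1]
* H. Xu et al., Science 384 (2024) eadh7691, eq. (1) (the `t–t'` model with a `d`-wave pinning field).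
  [cite: XuEtAl2024, eq. (1) p. 2]
-/

noncomputable section

namespace Literature.MathematicalPhysics.QuantumLattice

open _root_.Matrix Finset HubbardWave0 Literature.Probability.LatticeModels _root_.Filter
open scoped _root_.Topology

/-- **The sourced `t–t'` energy-density observable at the origin**
`E^src(t',U,μ,h) = Γ(E_Φ(1,t',U)) − μ (n_{0↑} + n_{0↓}) − h (Γ Φ₀ + (Γ Φ₀)†) ∈ 𝔄_W`, `Φ₀` the `d`-wave
pair word of the origin: the local objective whose torus translates sum to `dWaveSourceTorusTT' L t' U μ h`.
[cite: KomaTasaki1994, §1] -/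
def dWaveSourceEnergyObsTT' (t' U μ h : ℝ) : FermionOp dWaveSourceWindow :=
  fermionEmbed (PolySite.incl (Finset.subset_union_left : thicken ({0} : Finset (Site 2)) 1 ⊆ dWaveSourceWindow))
      ((hubbardTTPrimeFermionInteraction 1 t' U).meanEnergyObs 1) -
    (μ : ℂ) • ∑ σ : Fin 2, nAt 0 ((Finset.subset_union_left : thicken ({0} : Finset (Site 2)) 1 ⊆ dWaveSourceWindow)
        (subset_thicken _ _ (Finset.mem_singleton_self _))) σ -
    (h : ℂ) • (fermionEmbed (PolySite.incl
          (Finset.subset_union_right : pairRegion (insert (0 : Site 2) unitSteps) 0 ⊆ dWaveSourceWindow))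
        (localPairAt (insert (0 : Site 2) unitSteps) dWaveFormFactor 0) +
      (fermionEmbed (PolySite.incl
          (Finset.subset_union_right : pairRegion (insert (0 : Site 2) unitSteps) 0 ⊆ dWaveSourceWindow))
        (localPairAt (insert (0 : Site 2) unitSteps) dWaveFormFactor 0))ᴴ)

/-- **The thermodynamic-limit ground-state energy density of the pair-sourced `t–t'` Hubbard torus**
`e_src(t', U, μ, h) = lim_{L → ∞} E₀(A_L(t',U,μ,h)) / L²` (`limUnder` along the sides `L + 1`; the limit
exists for all real `t', U, μ, h` — `tendsto_dWaveSourceEnergyDensityTT'` in the companion file).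
[cite: KomaTasaki1994, §1] -/
def dWaveSourceEnergyDensityTT' (t' U μ h : ℝ) : ℝ :=
  limUnder atTop (fun L : ℕ =>
    (dWaveSourceTorusTT' (L + 1) t' U μ h).groundEnergy / (((L + 1 : ℕ) : ℝ)) ^ 2)

end Literature.MathematicalPhysics.QuantumLattice

end
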